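import Summits.NavierStokesRegularity.NavierStokesRegularity.Theorems.TypeICertificateLadderTargetFlowwiseDepletionSlab
import Summits.NavierStokesRegularity.NavierStokesRegularity.Theorems.TypeICertificateLadderTargetRungOfDepletion
import Summits.NavierStokesRegularity.NavierStokesRegularity.Theorems.TypeICertificateLadderTargetDepletionAlignmentIdentity
import HarnessLib

/-!
# Crux `Target` = `TypeICertificateLadder.NoTypeIBlowup` (stmt-NavierStokesRegularity-1217), line
# `depletion-ladder`: RUNGS FROM FLOW-WISE DEPLETION, and the velocity–palinstrophy ALIGNMENT CRITERION

`--supports stmt-NavierStokesRegularity-1217` (third file of the flow-wise version of the landed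
conditional rung S2 `Theorems.rung_of_stretchingDepletion`; companions
`…TargetFlowwiseDepletionSlice.lean`, `…TargetFlowwiseDepletionSlab.lean`; consumer of the seat's
structure files `…TargetDepletionAlignmentDefect.lean` / `…TargetDepletionAlignmentIdentity.lean`).

* `lintegral_curl_sq_le_rpow_of_rate_flowwise`, `energy_add_enstrophy_le_rpow_of_rate_flowwise` —
  the depleted enstrophy Grönwall `‖u(t)‖₂² + ‖∇u(t)‖₂² ≤ K(T−t)^{−κ²C²/2}` for a classical
  Leray–Hopf rapidly-decaying-datum solution on `[0,T)` with eventual rate `√(T−t)‖u‖ ≤ C√ν`, under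
  the depletion bound `|∫⟪ω(t), Du(t) ω(t)⟫| ≤ κ M ‖ω(t)‖₂ ‖∇ω(t)‖₂` (`M` any bound of `|u(t)|`)
  ALONG THE SOLUTION on `[0,T)` instead of the universal law (proofs verbatim the landed
  `…TargetDepletedEnstrophyDecay.lean`).
* `rung_of_flowwiseDepletion` — **flow-wise S2**: such a solution extends smoothly past `T` as soon
  as `κ ≥ 0` and `κ·C < 1`. This is the glue by which ANY a-priori depletion estimate valid along
  Leray–Hopf flows (not necessarily a universal functional inequality) lifts the ladder.
* `hasSmoothExtensionPast_of_alignedPalinstrophyFraction` — **the alignment criterion**, first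
  instance: if along the solution the aligned palinstrophy fraction stays above `η²`,
  `∫ ⟪u(t), curl ω(t)⟫²/‖u(t)‖² ≥ η² ∫|∇ω(t)|²_F` for all `t ∈ [0,T)`, then the direction-defect law
  `R² + A ≤ 1` (`sq_integral_stretching_le_direction_defect`, `integral_norm_curl_curl_sq_eq`) gives
  flow-wise depletion `κ = √(1 − η²)`, hence a classical extension past `T` whenever
  `(1 − η²)·C² < 1`. Contrapositive: a Type-I blow-up at dimensionless rate `C` must DECORRELATE the
  velocity from the palinstrophy field, `A(t) < 1 − C⁻²` at some time — for `C` near the ladder's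
  reach `A` must come close to `0`, whereas the numerical maximisers of the depletion ratio (kit jobs
  of this seat on 1217, `R ≈ 0.14`) sit at `A ≈ 0.8`. A falsifiable, DNS-measurable quantity for the
  cell's instrument line (`A(t)` on near-max episodes).

WHAT THIS IS NOT: not a rung (both statements are CONDITIONAL on a property of the solution: doors,
≡ Target mod NoTypeII by the door calculus as far as closing power goes); no depletion constant is
proved. Elementary given the landed chain. [folklore]

References: Leray 1934 §§19–20; Lemarié-Rieusset (2016), Thm. 11.2; Robinson–Rodrigo–Sadowski (2016),
Lemma 6.11 / Lemma 8.16; T. Tao, arXiv:1108.1165, Thm. 5.4 / Cor. 11.1.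
-/

noncomputable section

open Set Filter Topology MeasureTheory
open scoped RealInnerProductSpace ENNReal NNReal Laplacian ContDiff
open Literature.Analysis.FluidPDE

namespace Summit.NavierStokesRegularity.NavierStokesRegularity.Theorems.DepletionLadder

-- the problem directory repeats the summit name (`NavierStokesRegularity/NavierStokesRegularity`)
set_option linter.dupNamespace false

open Summit.NavierStokesRegularity.NavierStokesRegularity.Theorems.RungReynoldsOne
open Summit.NavierStokesRegularity.NavierStokesRegularity.Theorems.SimilarityEnstrophy

/-- **Depleted enstrophy Grönwall against the rate, flow-wise form.** For a classical Leray–Hopf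
rapidly-decaying-datum solution on `ℝ³ × [0,T)` with eventual rate `√(T−t)‖u(t,x)‖ ≤ C√ν`,
satisfying the depletion bound with constant `κ` along the solution on `[0,T)`, there is `K ≥ 0`
with `∫‖curl u(t)‖² ≤ K (T−t)^{−κ²C²/2}` for all `t ∈ (0,T)` (Tao cover on `[0,t]`, flow-wise slab
inequality, `∫₀ᵗ‖u‖²_∞ ≤ B₀²T + C²ν log(T/(T−t))`). [folklore] -/
theorem lintegral_curl_sq_le_rpow_of_rate_flowwise {ν κ T C : ℝ} (hν : 0 < ν) (hT : 0 < T)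
    {u : ℝ → EuclideanSpace ℝ (Fin 3) → EuclideanSpace ℝ (Fin 3)}
    {p : ℝ → EuclideanSpace ℝ (Fin 3) → ℝ}
    (hsol : IsClassicalNSSolutionOn (Ico 0 T) ν 0 u p) (hLH : IsLerayHopfOn T ν 0 (u 0) u)
    (hdec : HasRapidSpatialDecay (u 0))
    (hflow : ∀ t ∈ Ico 0 T, ∀ M : ℝ, (∀ x, ‖u t x‖ ≤ M) →
      |∫ x, ⟪curl (u t) x, fderiv ℝ (u t) x (curl (u t) x)⟫| ≤
        κ * M * Real.sqrt (∫ x, ‖curl (u t) x‖ ^ 2) *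
          Real.sqrt (∫ x, frobeniusNormSq (fderiv ℝ (curl (u t)) x)))
    (hrate : ∀ᶠ t in 𝓝[<] T, ∀ x, Real.sqrt (T - t) * ‖u t x‖ ≤ C * Real.sqrt ν) :
    ∃ K : ℝ, 0 ≤ K ∧ ∀ t ∈ Ioo 0 T,
      ∫⁻ x, ‖curl (u t) x‖ₑ ^ 2 ≤ ENNReal.ofReal (K * (T - t) ^ (-(κ ^ 2 * C ^ 2 / 2))) := by
  -- the onset `t₀ ∈ (0, T)` of the rate
  obtain ⟨a, haT, hsub⟩ := mem_nhdsLT_iff_exists_Ioo_subset.1 hrate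
  set t₀ : ℝ := (max a (T / 2) + T) / 2 with ht₀def
  have hmax : max a (T / 2) < T := max_lt haT (by linarith)
  have hat₀ : a < t₀ := by
    have := le_max_left a (T / 2); rw [ht₀def]; linarith
  have ht₀ : t₀ ∈ Ioo 0 T := by
    have := le_max_right a (T / 2); rw [ht₀def]; constructor <;> linarith
  have hrate' : ∀ s ∈ Ico t₀ T, ∀ x, Real.sqrt (T - s) * ‖u s x‖ ≤ C * Real.sqrt ν :=
    fun s hs => hsub ⟨hat₀.trans_le hs.1, hs.2⟩
  -- a sup bound on `[0, t₀]` from the Tao cover at `T' = t₀`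
  obtain ⟨q₀, hsol₀, hu₀, -, -⟩ := stub_taoCover hν hT hsol hLH hdec ht₀
  obtain ⟨B₀, hB₀0, hB₀⟩ := exists_forall_norm_le_of_hasBoundedSobolevNormsOn hsol₀ hu₀
  obtain ⟨C₁, hC₁⟩ := hu₀ 1
  -- the sup-norm bound `‖u(s)‖²_∞ ≤ B₀² + C²ν/(T−s)` on `[0, T)`
  have hNsq : ∀ s ∈ Ico 0 T, (eLpNorm (u s) ⊤ volume).toReal ^ (2 : ℝ) ≤
      B₀ ^ 2 + C ^ 2 * ν / (T - s) := by
    intro s hs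
    have hTs : 0 < T - s := sub_pos.2 hs.2
    rw [Real.rpow_two]
    by_cases hst : s < t₀
    · have h1 : (eLpNorm (u s) ⊤ volume).toReal ≤ B₀ :=
        toReal_eLpNorm_top_le_of_bound hB₀0 (hB₀ s ⟨hs.1, hst.le⟩)
      have h2 : 0 ≤ C ^ 2 * ν / (T - s) := by positivity
      nlinarith [ENNReal.toReal_nonneg (a := eLpNorm (u s) ⊤ volume)]
    · have hb : 0 ≤ Real.sqrt (C ^ 2 * ν / (T - s)) := Real.sqrt_nonneg _
      have h1 : ∀ x, ‖u s x‖ ≤ Real.sqrt (C ^ 2 * ν / (T - s)) := fun x =>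
        Real.le_sqrt_of_sq_le
          (sq_norm_le_of_rate_mul hν.le hs.2 (hrate' s ⟨not_lt.1 hst, hs.2⟩ x))
      have h2 : (eLpNorm (u s) ⊤ volume).toReal ≤ Real.sqrt (C ^ 2 * ν / (T - s)) :=
        toReal_eLpNorm_top_le_of_bound hb h1
      have h3 := pow_le_pow_left₀ ENNReal.toReal_nonneg h2 2
      rw [Real.sq_sqrt (by positivity)] at h3
      nlinarith [sq_nonneg B₀]
  -- the integrated sup-norm bound `Λ(t) ≤ B₀²T + C²ν log(T/(T−t))`
  have hΛ : ∀ t ∈ Ioo 0 T,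
      ∫⁻ s in Ioo 0 t, ENNReal.ofReal ((eLpNorm (u s) ⊤ volume).toReal ^ (2 : ℝ)) ≤
        ENNReal.ofReal (B₀ ^ 2 * T + C ^ 2 * ν * Real.log (T / (T - t))) := by
    intro t ht
    have hTt : 0 < T - t := sub_pos.2 ht.2
    have hlog : 0 ≤ Real.log (T / (T - t)) :=
      Real.log_nonneg ((one_le_div hTt).2 (by linarith [ht.1]))
    have hC2 : 0 ≤ C ^ 2 * ν := by positivity
    calc ∫⁻ s in Ioo 0 t, ENNReal.ofReal ((eLpNorm (u s) ⊤ volume).toReal ^ (2 : ℝ))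
        ≤ ∫⁻ s in Ioo 0 t, (ENNReal.ofReal (B₀ ^ 2) + ENNReal.ofReal (C ^ 2 * ν / (T - s))) := by
          refine setLIntegral_mono' measurableSet_Ioo fun s hs => ?_
          rw [← ENNReal.ofReal_add (sq_nonneg _) (div_nonneg hC2 (by linarith [hs.2, ht.2]))]
          exact ENNReal.ofReal_le_ofReal (hNsq s ⟨hs.1.le, hs.2.trans ht.2⟩)
      _ = ENNReal.ofReal (B₀ ^ 2) * volume (Ioo 0 t) +
            ∫⁻ s in Ioo 0 t, ENNReal.ofReal (C ^ 2 * ν / (T - s)) := by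
          rw [lintegral_add_left measurable_const, setLIntegral_const]
      _ = ENNReal.ofReal (B₀ ^ 2 * t) + ENNReal.ofReal (C ^ 2 * ν * Real.log (T / (T - t))) := by
          rw [lintegral_Ioo_div_sub_eq hC2 ht.1.le ht.2, Real.volume_Ioo, sub_zero,
            ← ENNReal.ofReal_mul (sq_nonneg _)]
      _ = ENNReal.ofReal (B₀ ^ 2 * t + C ^ 2 * ν * Real.log (T / (T - t))) :=
          (ENNReal.ofReal_add (mul_nonneg (sq_nonneg _) ht.1.le) (mul_nonneg hC2 hlog)).symm
      _ ≤ ENNReal.ofReal (B₀ ^ 2 * T + C ^ 2 * ν * Real.log (T / (T - t))) := by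
          refine ENNReal.ofReal_le_ofReal ?_
          nlinarith [sq_nonneg B₀, ht.2]
  -- finiteness of the enstrophy at time `0`
  have h00 : (0 : ℝ) ∈ Icc 0 t₀ := ⟨le_rfl, ht₀.1.le⟩
  have hZ0 : ∫⁻ x, ‖curl (u 0) x‖ₑ ^ 2 ≤ 6 * C₁ := by
    calc ∫⁻ x, ‖curl (u 0) x‖ₑ ^ 2 ≤ ∫⁻ x, 6 * ‖iteratedFDeriv ℝ 1 (u 0) x‖ₑ ^ 2 :=
          lintegral_mono fun x => enorm_curl_sq_le_six_mul (u 0) x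
      _ = 6 * ∫⁻ x, ‖iteratedFDeriv ℝ 1 (u 0) x‖ₑ ^ 2 := lintegral_const_mul' _ _ (by norm_num)
      _ ≤ 6 * C₁ := by gcongr; exact hC₁ 0 h00
  have hZ0top : ∫⁻ x, ‖curl (u 0) x‖ₑ ^ 2 ≠ ⊤ :=
    (hZ0.trans_lt (ENNReal.mul_lt_top (by norm_num) ENNReal.coe_lt_top)).ne
  set Z0 : ℝ := (∫⁻ x, ‖curl (u 0) x‖ₑ ^ 2).toReal with hZ0def
  have hZ0nn : 0 ≤ Z0 := ENNReal.toReal_nonneg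
  -- the constant
  set kν : ℝ := κ ^ 2 / (2 * ν) with hkν
  have hk0 : 0 ≤ kν := by positivity
  set γ : ℝ := κ ^ 2 * C ^ 2 / 2 with hγ
  have hγk : kν * (C ^ 2 * ν) = γ := by
    rw [hkν, hγ]
    field_simp
  set K : ℝ := Real.exp (kν * (B₀ ^ 2 * T)) * T ^ γ * Z0 with hK
  refine ⟨K, by positivity, fun t ht => ?_⟩
  obtain ⟨q, hsolt, hut, hutt, -⟩ := stub_taoCover hν hT hsol hLH hdec ht
  have hTt : 0 < T - t := sub_pos.2 ht.2
  have hΛt := hΛ t ht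
  have hΛtop : ∫⁻ s in Ioo 0 t, ENNReal.ofReal ((eLpNorm (u s) ⊤ volume).toReal ^ (2 : ℝ)) ≠ ⊤ :=
    (hΛt.trans_lt ENNReal.ofReal_lt_top).ne
  have hflow_t : ∀ s ∈ Icc 0 t, ∀ M : ℝ, (∀ x, ‖u s x‖ ≤ M) →
      |∫ x, ⟪curl (u s) x, fderiv ℝ (u s) x (curl (u s) x)⟫| ≤
        κ * M * Real.sqrt (∫ x, ‖curl (u s) x‖ ^ 2) *
          Real.sqrt (∫ x, frobeniusNormSq (fderiv ℝ (curl (u s)) x)) :=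
    fun s hs => hflow s ⟨hs.1, hs.2.trans_lt ht.2⟩
  have hmain := lintegral_curl_sq_le_exp_of_flowwise hν ht.1 hsolt hflow_t hut hutt ⟨ht.1, le_rfl⟩ hΛtop
  refine hmain.trans ?_
  have hlog : 0 ≤ Real.log (T / (T - t)) :=
    Real.log_nonneg ((one_le_div hTt).2 (by linarith [ht.1]))
  have hrhs0 : 0 ≤ B₀ ^ 2 * T + C ^ 2 * ν * Real.log (T / (T - t)) := by positivity
  have hexp : Real.exp (κ ^ 2 / (2 * ν) *
      (∫⁻ s in Ioo 0 t, ENNReal.ofReal ((eLpNorm (u s) ⊤ volume).toReal ^ (2 : ℝ))).toReal) ≤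
      Real.exp (kν * (B₀ ^ 2 * T)) * (T / (T - t)) ^ γ := by
    have h1 : (∫⁻ s in Ioo 0 t, ENNReal.ofReal ((eLpNorm (u s) ⊤ volume).toReal ^ (2 : ℝ))).toReal ≤
        B₀ ^ 2 * T + C ^ 2 * ν * Real.log (T / (T - t)) := ENNReal.toReal_le_of_le_ofReal hrhs0 hΛt
    have h2 := Real.exp_le_exp.2 (mul_le_mul_of_nonneg_left h1 hk0)
    refine h2.trans_eq ?_
    rw [exp_mul_add_mul_log (div_pos hT hTt), hγk]
  have hpow : (T / (T - t)) ^ γ = T ^ γ * (T - t) ^ (-γ) := by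
    rw [Real.div_rpow hT.le hTt.le, Real.rpow_neg hTt.le, div_eq_mul_inv]
  calc ENNReal.ofReal (Real.exp (κ ^ 2 / (2 * ν) *
        (∫⁻ s in Ioo 0 t, ENNReal.ofReal ((eLpNorm (u s) ⊤ volume).toReal ^ (2 : ℝ))).toReal)) *
        ∫⁻ x, ‖curl (u 0) x‖ₑ ^ 2
      ≤ ENNReal.ofReal (Real.exp (kν * (B₀ ^ 2 * T)) * (T / (T - t)) ^ γ) * ENNReal.ofReal Z0 := by
        rw [ENNReal.ofReal_toReal hZ0top]
        gcongr
    _ = ENNReal.ofReal (K * (T - t) ^ (-γ)) := by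
        rw [← ENNReal.ofReal_mul (by positivity), hpow, hK]
        ring_nf

/-- **The `H¹`-type power rate under rate `C` and depletion `κ`** (flow-wise form): under the depletion bound with constant `κ` ALONG the solution on `[0,T)`, along every classical
Leray–Hopf rapidly-decaying-datum solution on `[0,T)` with eventual rate `√(T−t)‖u(t,x)‖ ≤ C√ν`,
`‖u(t)‖₂² + ‖∇u(t)‖₂² ≤ K′(T−t)^{−κ²C²/2}` for all `t ∈ [T/2, T)`: energy
`≤ 2E(u₀)` (`IsLerayHopfOn.lintegral_enorm_sq_le`), `∫|∇u|² ≤ ∫|curl u|²`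
(`lintegral_frobeniusNormSq_fderiv_le_lintegral_sq_norm_curl`) and
`lintegral_curl_sq_le_rpow_of_rate_flowwise`. [folklore] -/
theorem energy_add_enstrophy_le_rpow_of_rate_flowwise {ν κ T C : ℝ} (hν : 0 < ν) (hT : 0 < T)
    {u : ℝ → EuclideanSpace ℝ (Fin 3) → EuclideanSpace ℝ (Fin 3)}
    {p : ℝ → EuclideanSpace ℝ (Fin 3) → ℝ}
    (hsol : IsClassicalNSSolutionOn (Ico 0 T) ν 0 u p) (hLH : IsLerayHopfOn T ν 0 (u 0) u)
    (hdec : HasRapidSpatialDecay (u 0))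
    (hflow : ∀ t ∈ Ico 0 T, ∀ M : ℝ, (∀ x, ‖u t x‖ ≤ M) →
      |∫ x, ⟪curl (u t) x, fderiv ℝ (u t) x (curl (u t) x)⟫| ≤
        κ * M * Real.sqrt (∫ x, ‖curl (u t) x‖ ^ 2) *
          Real.sqrt (∫ x, frobeniusNormSq (fderiv ℝ (curl (u t)) x)))
    (hrate : ∀ᶠ t in 𝓝[<] T, ∀ x, Real.sqrt (T - t) * ‖u t x‖ ≤ C * Real.sqrt ν) :
    ∃ K : ℝ, ∃ t₀ ∈ Ico 0 T, ∀ t ∈ Ico t₀ T,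
      (∫⁻ x, ‖u t x‖ₑ ^ 2) + ∫⁻ x, ENNReal.ofReal (frobeniusNormSq (fderiv ℝ (u t) x)) ≤
        ENNReal.ofReal (K * (T - t) ^ (-(κ ^ 2 * C ^ 2 / 2))) := by
  obtain ⟨K, hK0, hK⟩ := lintegral_curl_sq_le_rpow_of_rate_flowwise hν hT hsol hLH hdec hflow hrate
  set γ : ℝ := κ ^ 2 * C ^ 2 / 2 with hγ
  have hγ0 : 0 ≤ γ := by positivity
  set E₀ : ℝ := 2 * VectorCalculus.kineticEnergy (u 0) with hE₀
  -- the energy bound, made nonnegative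
  have hE : ∀ t ∈ Icc 0 T, ∫⁻ x, ‖u t x‖ₑ ^ 2 ≤ ENNReal.ofReal (max E₀ 0) := fun t ht =>
    (hLH.lintegral_enorm_sq_le hν.le ht).trans (ENNReal.ofReal_le_ofReal (le_max_left _ _))
  refine ⟨max E₀ 0 * T ^ γ + K, T / 2, ⟨by positivity, by linarith⟩, fun t ht => ?_⟩
  have ht' : t ∈ Ioo 0 T := ⟨lt_of_lt_of_le (by positivity) ht.1, ht.2⟩
  have htc : t ∈ Icc 0 T := ⟨ht'.1.le, ht'.2.le⟩
  have htI : t ∈ Ico 0 T := ⟨ht'.1.le, ht'.2⟩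
  have hTt : 0 < T - t := sub_pos.2 ht.2
  -- `∫|∇u(t)|² ≤ ∫|curl u(t)|²`
  have hL2 : ∫⁻ x, ‖u t x‖ₑ ^ 2 < ⊤ := (hE t htc).trans_lt ENNReal.ofReal_lt_top
  have hG : ∫⁻ x, ENNReal.ofReal (frobeniusNormSq (fderiv ℝ (u t) x)) ≤ ∫⁻ x, ‖curl (u t) x‖ₑ ^ 2 :=
    lintegral_frobeniusNormSq_fderiv_le_lintegral_sq_norm_curl
      ((hsol.contDiff_velocity htI).of_le (by norm_cast)) (hsol.divFree t htI) hL2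
  -- `max E₀ 0 ≤ max E₀ 0 · T^γ (T−t)^{−γ}`
  have hone : 1 ≤ T ^ γ * (T - t) ^ (-γ) := by
    rw [Real.rpow_neg hTt.le, ← div_eq_mul_inv, ← Real.div_rpow hT.le hTt.le]
    exact Real.one_le_rpow ((one_le_div hTt).2 (by linarith [ht'.1])) hγ0
  have hE' : max E₀ 0 ≤ max E₀ 0 * T ^ γ * (T - t) ^ (-γ) := by
    have := mul_le_mul_of_nonneg_left hone (le_max_right E₀ 0)
    rw [mul_one] at this
    simpa [mul_assoc] using this
  calc (∫⁻ x, ‖u t x‖ₑ ^ 2) + ∫⁻ x, ENNReal.ofReal (frobeniusNormSq (fderiv ℝ (u t) x))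
      ≤ ENNReal.ofReal (max E₀ 0) + ENNReal.ofReal (K * (T - t) ^ (-γ)) :=
        add_le_add (hE t htc) (hG.trans (hK t ht'))
    _ = ENNReal.ofReal (max E₀ 0 + K * (T - t) ^ (-γ)) :=
        (ENNReal.ofReal_add (le_max_right _ _) (by positivity)).symm
    _ ≤ ENNReal.ofReal ((max E₀ 0 * T ^ γ + K) * (T - t) ^ (-γ)) := by
        refine ENNReal.ofReal_le_ofReal ?_
        rw [add_mul]
        exact add_le_add hE' le_rfl

/-- **Flow-wise S2: rungs from depletion along the solution.** Let `u` be a classical solution of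
the unforced Navier–Stokes system on `ℝ³ × [0,T)` (`ν, T > 0`), Leray–Hopf from its rapidly decaying
datum, with eventual dimensionless rate `√(T−t)‖u(t,x)‖ ≤ C√ν`. If for some `κ ≥ 0` with `κC < 1`
the depletion bound `|∫⟪ω(t), Du(t) ω(t)⟫| ≤ κ M ‖ω(t)‖₂ ‖∇ω(t)‖₂` holds for every `t ∈ [0,T)` and
every bound `M` of `|u(t)|`, then `u` extends smoothly past `T`. (Raise `κ` to
`κ' = (1 + κC)/(2C) > 0`, `κ'C < 1`; depleted Grönwall exponent `κ'²C²/2 < 1/2` against the `H¹`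
blow-up rate, `hasSmoothExtensionPast_of_powerRate`.) [folklore] -/
theorem rung_of_flowwiseDepletion {ν κ T C : ℝ} (hν : 0 < ν) (hT : 0 < T) (hκ : 0 ≤ κ)
    (hC : 0 < C) (hκC : κ * C < 1)
    {u : ℝ → EuclideanSpace ℝ (Fin 3) → EuclideanSpace ℝ (Fin 3)}
    {p : ℝ → EuclideanSpace ℝ (Fin 3) → ℝ}
    (hsol : IsClassicalNSSolutionOn (Ico 0 T) ν 0 u p) (hLH : IsLerayHopfOn T ν 0 (u 0) u)
    (hdec : HasRapidSpatialDecay (u 0))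
    (hflow : ∀ t ∈ Ico 0 T, ∀ M : ℝ, (∀ x, ‖u t x‖ ≤ M) →
      |∫ x, ⟪curl (u t) x, fderiv ℝ (u t) x (curl (u t) x)⟫| ≤
        κ * M * Real.sqrt (∫ x, ‖curl (u t) x‖ ^ 2) *
          Real.sqrt (∫ x, frobeniusNormSq (fderiv ℝ (curl (u t)) x)))
    (hrate : ∀ᶠ t in 𝓝[<] T, ∀ x, Real.sqrt (T - t) * ‖u t x‖ ≤ C * Real.sqrt ν) :
    HasSmoothExtensionPast ν 0 u T := by
  -- raise `κ` to a positive constant `κ'` with `κ' C < 1`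
  set κ' : ℝ := (1 + κ * C) / (2 * C) with hκ'
  have hκ'pos : 0 < κ' := by rw [hκ']; positivity
  have hκ'C : κ' * C < 1 := by
    rw [hκ', div_mul_eq_mul_div, div_lt_one (by positivity)]
    nlinarith
  have hκle : κ ≤ κ' := by
    rw [hκ', le_div_iff₀ (by positivity)]
    nlinarith
  have hflow' : ∀ t ∈ Ico 0 T, ∀ M : ℝ, (∀ x, ‖u t x‖ ≤ M) →
      |∫ x, ⟪curl (u t) x, fderiv ℝ (u t) x (curl (u t) x)⟫| ≤
        κ' * M * Real.sqrt (∫ x, ‖curl (u t) x‖ ^ 2) *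
          Real.sqrt (∫ x, frobeniusNormSq (fderiv ℝ (curl (u t)) x)) := by
    intro t ht M hM
    have hM0 : 0 ≤ M := (norm_nonneg (u t 0)).trans (hM 0)
    refine (hflow t ht M hM).trans ?_
    have hA : 0 ≤ Real.sqrt (∫ x, ‖curl (u t) x‖ ^ 2) := Real.sqrt_nonneg _
    have hB : 0 ≤ Real.sqrt (∫ x, frobeniusNormSq (fderiv ℝ (curl (u t)) x)) := Real.sqrt_nonneg _
    have h1 : κ * M ≤ κ' * M := mul_le_mul_of_nonneg_right hκle hM0
    exact mul_le_mul_of_nonneg_right (mul_le_mul_of_nonneg_right h1 hA) hB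
  have hγ : κ' ^ 2 * C ^ 2 / 2 < 1 / 2 := by
    have h0 : 0 < κ' * C := mul_pos hκ'pos hC
    have h1 : (κ' * C) ^ 2 < 1 := by nlinarith
    rw [mul_pow] at h1
    linarith
  obtain ⟨K, t₀, ht₀, hK⟩ :=
    energy_add_enstrophy_le_rpow_of_rate_flowwise hν hT hsol hLH hdec hflow' hrate
  exact hasSmoothExtensionPast_of_powerRate hν hT hγ hsol hLH hdec ⟨t₀, ht₀, hK⟩

/-- **The velocity–palinstrophy ALIGNMENT CRITERION.** Let `u` be a classical solution of the
unforced Navier–Stokes system on `ℝ³ × [0,T)` (`ν, T > 0`), Leray–Hopf from its rapidly decaying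
datum, with eventual dimensionless rate `√(T−t)‖u(t,x)‖ ≤ C√ν` (`C > 0`). If for some `η ∈ [0, 1]`
with `(1 − η²)·C² < 1` the ALIGNED PALINSTROPHY FRACTION stays above `η²` along the solution,
`η² ∫|∇ω(t)|²_F ≤ ∫ ⟪u(t), curl ω(t)⟫²/‖u(t)‖²` for all `t ∈ [0,T)` (`ω = curl u`), then `u` extends
smoothly past `T`. Proof: at each slice the direction-defect law
`sq_integral_stretching_le_direction_defect` with `‖curl ω‖₂ = ‖∇ω‖₂`
(`integral_norm_curl_curl_sq_eq`) gives the flow-wise depletion bound with `κ = √(1 − η²)`;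
conclude by `rung_of_flowwiseDepletion`. Contrapositive (the criterion): a Type-I blow-up at rate
`C` forces `A(t) < 1 − C⁻²` at some time. [folklore] -/
theorem hasSmoothExtensionPast_of_alignedPalinstrophyFraction {ν T C η : ℝ} (hν : 0 < ν)
    (hT : 0 < T) (hC : 0 < C) (hη0 : 0 ≤ η) (hη1 : η ≤ 1) (hηC : (1 - η ^ 2) * C ^ 2 < 1)
    {u : ℝ → EuclideanSpace ℝ (Fin 3) → EuclideanSpace ℝ (Fin 3)}
    {p : ℝ → EuclideanSpace ℝ (Fin 3) → ℝ}
    (hsol : IsClassicalNSSolutionOn (Ico 0 T) ν 0 u p) (hLH : IsLerayHopfOn T ν 0 (u 0) u)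
    (hdec : HasRapidSpatialDecay (u 0))
    (hA : ∀ t ∈ Ico 0 T, η ^ 2 * ∫ x, frobeniusNormSq (fderiv ℝ (curl (u t)) x) ≤
      ∫ x, ⟪u t x, curl (curl (u t)) x⟫ ^ 2 / ‖u t x‖ ^ 2)
    (hrate : ∀ᶠ t in 𝓝[<] T, ∀ x, Real.sqrt (T - t) * ‖u t x‖ ≤ C * Real.sqrt ν) :
    HasSmoothExtensionPast ν 0 u T := by
  set κ : ℝ := Real.sqrt (1 - η ^ 2) with hκdef
  have h1η : 0 ≤ 1 - η ^ 2 := by nlinarith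
  have hκ0 : 0 ≤ κ := Real.sqrt_nonneg _
  have hκ2 : κ ^ 2 = 1 - η ^ 2 := Real.sq_sqrt h1η
  have hκC : κ * C < 1 := by
    have h : (κ * C) ^ 2 < 1 := by rw [mul_pow, hκ2]; exact hηC
    have h0 : 0 ≤ κ * C := mul_nonneg hκ0 hC.le
    nlinarith
  refine rung_of_flowwiseDepletion hν hT hκ0 hC hκC hsol hLH hdec (fun t ht M hM => ?_) hrate
  -- the slice at time `t`: a Tao-class slab `[0, t']` through it supplies the integrability package
  have ht' : (t + T) / 2 ∈ Ioo 0 T := ⟨by linarith [ht.1], by linarith [ht.2]⟩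
  obtain ⟨q, hsolt, hut, -, -⟩ := stub_taoCover hν hT hsol hLH hdec ht'
  have htI : t ∈ Icc 0 ((t + T) / 2) := ⟨ht.1, by linarith [ht.2]⟩
  obtain ⟨iZ, iA, iJ⟩ := slice_integrability hsolt hut htI
  have hv3 : ContDiff ℝ 3 (u t) := (hsol.contDiff_velocity ht).of_le (by norm_cast)
  have hv2 : ContDiff ℝ 2 (u t) := (hsol.contDiff_velocity ht).of_le (by norm_cast)
  have hdiv : VectorCalculus.IsDivFree (u t) := hsol.divFree t ht
  -- the direction-defect law and the normalisation `‖curl ω‖₂ = ‖∇ω‖₂`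
  have hdef := sq_integral_stretching_le_direction_defect hv2 hdiv hM iZ iA iJ
  rw [integral_norm_curl_curl_sq_eq hv3 iZ iA] at hdef
  set Z : ℝ := ∫ x, ‖curl (u t) x‖ ^ 2 with hZ
  set W : ℝ := ∫ x, frobeniusNormSq (fderiv ℝ (curl (u t)) x) with hW
  set J : ℝ := ∫ x, ⟪curl (u t) x, fderiv ℝ (u t) x (curl (u t) x)⟫ with hJ
  have hZ0 : 0 ≤ Z := integral_nonneg fun x => sq_nonneg _
  have hW0 : 0 ≤ W := integral_nonneg fun x => frobeniusNormSq_nonneg _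
  have hM0 : 0 ≤ M := (norm_nonneg (u t 0)).trans (hM 0)
  -- `J² ≤ M² Z (W − ∫a) ≤ M² Z W (1 − η²) = (κ M √Z √W)²`
  have hJ2 : J ^ 2 ≤ (κ * M * Real.sqrt Z * Real.sqrt W) ^ 2 := by
    have hAt := hA t ht
    have hMZ : 0 ≤ M ^ 2 * Z := mul_nonneg (sq_nonneg _) hZ0
    calc J ^ 2 ≤ M ^ 2 * Z * (W - ∫ x, ⟪u t x, curl (curl (u t)) x⟫ ^ 2 / ‖u t x‖ ^ 2) := hdef
      _ ≤ M ^ 2 * Z * (W * (1 - η ^ 2)) := by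
          refine mul_le_mul_of_nonneg_left ?_ hMZ
          linarith
      _ = (κ * M * Real.sqrt Z * Real.sqrt W) ^ 2 := by
          rw [mul_pow, mul_pow, mul_pow, hκ2, Real.sq_sqrt hZ0, Real.sq_sqrt hW0]; ring
  have hR0 : 0 ≤ κ * M * Real.sqrt Z * Real.sqrt W := by positivity
  exact abs_le_of_sq_le_sq' hJ2 hR0 |> fun h => abs_le.2 h


/-- **The alignment criterion at a singular time** (contrapositive form). If the classical
Leray–Hopf rapidly-decaying-datum solution `u` on `[0,T)` with eventual dimensionless rate `C > 0`
does NOT extend smoothly past `T`, then for every `η ∈ [0,1]` with `(1 − η²)·C² < 1` there is a time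
`t ∈ [0,T)` at which the aligned palinstrophy fraction drops below `η²`:
`∫ ⟪u(t), curl ω(t)⟫²/‖u(t)‖² < η² ∫|∇ω(t)|²_F`. (For `C ↓ 1` the admissible `η²` tends to `0`: a
Type-I blow-up at the ladder's reach needs near-complete velocity–palinstrophy decorrelation.)
[folklore] -/
theorem exists_alignedPalinstrophyFraction_lt_of_not_hasSmoothExtensionPast {ν T C η : ℝ}
    (hν : 0 < ν) (hT : 0 < T) (hC : 0 < C) (hη0 : 0 ≤ η) (hη1 : η ≤ 1)
    (hηC : (1 - η ^ 2) * C ^ 2 < 1)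
    {u : ℝ → EuclideanSpace ℝ (Fin 3) → EuclideanSpace ℝ (Fin 3)}
    {p : ℝ → EuclideanSpace ℝ (Fin 3) → ℝ}
    (hsol : IsClassicalNSSolutionOn (Ico 0 T) ν 0 u p) (hLH : IsLerayHopfOn T ν 0 (u 0) u)
    (hdec : HasRapidSpatialDecay (u 0))
    (hrate : ∀ᶠ t in 𝓝[<] T, ∀ x, Real.sqrt (T - t) * ‖u t x‖ ≤ C * Real.sqrt ν)
    (hsing : ¬ HasSmoothExtensionPast ν 0 u T) :
    ∃ t ∈ Ico 0 T, ∫ x, ⟪u t x, curl (curl (u t)) x⟫ ^ 2 / ‖u t x‖ ^ 2 <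
      η ^ 2 * ∫ x, frobeniusNormSq (fderiv ℝ (curl (u t)) x) := by
  by_contra h
  push Not at h
  exact hsing (hasSmoothExtensionPast_of_alignedPalinstrophyFraction hν hT hC hη0 hη1 hηC hsol hLH
    hdec h hrate)

end Summit.NavierStokesRegularity.NavierStokesRegularity.Theorems.DepletionLadder

end
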